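import Literature.MathematicalPhysics.QuantumFieldTheory.Balaban1983to89.B9Eq325ProjFormulaTower
import Literature.MathematicalPhysics.QuantumFieldTheory.Balaban1983to89.B9Eq365QGGQLowerVariational
import Literature.MathematicalPhysics.QuantumFieldTheory.Balaban1983to89.B9Thm311SitePrimeFormCoercive

/-!
# `Balaban1983to89.B9Thm311FlatLettersTower` — T. Bałaban, *Propagators for lattice gauge theories in a background field*, Commun. Math. Phys.
# **99** (1985) 389–434 [Balaban1985BackgroundPropagators] Thm 3.11 p. 416 with (3.24)–(3.25) p. 394, (3.19) p. 393, (3.35) p. 396: **THE TWO FLAT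
# INPUT LETTERS OF PRINT's GREEN's-FUNCTION ROUTE FOR `R_k(U)` AT `k = n+1` LEVELS — the STRONG flat coercivity `γ♭ = 1∕(2+2∕a′)` of the site
# operator `Δ′_{a′,k}(1)` and the flat floor `κ♭` of the third operator `Q̃′_kG′_k(1)²Q̃′_k†` — ARE THE ONE-STEP LETTERS AT BLOCK SIZE `L^{n+1}`**
# (NE9 leaf-03's `B9Thm311SitePrimeFormCoercive.flat_site_strong_coercive` and NE9 leaf-01's `B9Eq365QGGQLowerVariational.qggq_coercive_one` ∕
# `qggq_constant_diagonal_ge`, consumed BY NAME through `B9Eq324DeltaPrimeATower` ∕ `B9Eq325ProjFormulaTower`'s flat identification); on print's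
# diagonal `ηL^{n+1} = 1`, `c₀(L^{n+1})^d = c₁` both are functions of `(d, a′)` ONLY — free of `η`, `L`, the volume AND the number of levels

statement-level skeleton of published theorems with citation tags; proofs where landed; nothing here is a claim about the Yang–Mills mass gap

CITATION HEADER (lean-in-tree rule).  Audit cell `pub-balaban`, sub-cell `t4`, BINDER row NE9; filed by the row OWNER lineage `b2b-balaban-t4-ne9-p1`
(gen 85), INTENT I-ne9p1-g85-3.  Sources READ by this lineage in the held text `paper:balaban1985-cmp99-background-propagators` (journal page = PDF
page + 388): pp. 393–396, 416; [Balaban1984PropagatorsI] p. 20 ((1.18): a composition of `k` averagings at `U = 1` is the averaging over blocks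
of side `L^k`).

THE PRINT (verbatim).  p. 394, (3.24)–(3.25): *«Δ′_a = Δ_U + Q′*(U) a Q′(U) … G′ = (Δ′_a)⁻¹, R = Δ_U G′ Q′*(Q′G′²Q′*)⁻¹Q′G′»*; p. 416, Thm 3.11:
*«the operators Δ′_a, G′, (Q′G′²Q′*)⁻¹, Δ_a, G are positive definite.»*; p. 396, (3.35): the scaled small-field window; [B5] p. 20, (1.18): *«a
composition of k transformations is given by (1.17) where (Q_kA)_b = Σ_{x∈B^k(b₋)} η^{d+1} A([x, x(b)])»*.

WHY THIS FILE (cell context; the owner's DIAGNOSIS D-ne9p1-g85-1 and programme «ROUTE G ONE STOREY UP»).  The `k`-level `R`-Lipschitz letter — the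
one letter of (SC-k) not closed at the point (PRICING-NE9 v69) — closes level- and volume-free through print's (3.25) provided its two FLAT inputs
are level-free: the strong coercivity `γ♭` of the site operator and the floor `κ♭` of the third operator.  At `U ≡ 1` the `k`-level objects ARE
the one-step objects at block size `L^{n+1}` (`B9Eq316TowerFlatIsOneStep`, `B9Eq324DeltaPrimeATower.laplacePrimeAk_one_eq_oneStep`,
`B9Eq325ProjFormulaTower.QGGQk_one_eq_oneStep`), and the one-step letters are (η, m, L)-free along the diagonal — so at block `L^{n+1}` they are
free of the number of levels as well.  This file states the two readings; the `k`-level near-flat steps (NE9 leaf-03's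
`B9Thm311SitePrimeFormCoerciveCanonical`, NE9 leaf-06's `B9Eq364GreenLipschitzForm` ∕ `B9Eq325RLipschitzClosed`) port onto them.

WHAT IS PROVED (sorry-free; no `def`, no `Prop` placeholder; no inequality of the paper asserted).
* §1 `norm_covDerivL2K_one_siteL2Cast` (`‖D_1(Φ′λ)‖ = ‖D_1λ‖`); **`flat_site_strong_coercive_tower`** — along `c₁(ηL^{n+1})² = c₀(L^{n+1})^d`,
  `0 < ηL^{n+1}`, `η ≠ 0`, `0 < a′`: `(1∕(2+2∕a′))·(‖D_1λ‖² + (ηL^{n+1})⁻²‖λ‖²) ≤ re⟪λ, Δ′_{a′,k}(1)λ⟫` on `SiteL2K ℂ d (towerP L m (n+1)) c₀ W`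
  — leaf-03's S3b♭ at block `L^{n+1}`; **`flat_site_strong_coercive_tower_diagonal`** (`ηL^{n+1} = 1`: `(1∕(2+2∕a′))·(‖D_1λ‖² + ‖λ‖²) ≤ …`).
* §2 **`qggqk_coercive_one`** — `κ♭(L^{n+1}, η, c₀(L^{n+1})^d∕c₁, a′)·‖ψ‖² ≤ re⟪ψ, Q̃′_kG′_k(1)²Q̃′_k†ψ⟫` with leaf-01's explicit `κ♭` at block
  `L^{n+1}` (`3 ≤ L^{n+1}`, `η ≠ 0`, `0 < a′`); **`qggqk_coercive_one_diagonal`** — on the diagonal `ηL^{n+1} = 1`, `c₀(L^{n+1})^d = c₁`: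
  `(16d(729∕16)^d + a′)^{−2}·‖ψ‖² ≤ re⟪ψ, Q̃′_kG′_k(1)²Q̃′_k†ψ⟫` — a number depending on `d` and `a′` ONLY.
MODEL ∕ DECLARED READINGS.  As `B9Eq324DeltaPrimeATower`; the flat background only; the diagonal = print's `η = L^{−k}` unit-lattice normalisation
with the weights (3.16).  NOT HERE: anything at `U ≠ 1` (the near-flat steps are the leaves' storeys), any sharper `κ` (leaf-01's (S3c♯) ports
verbatim onto `QGGQk_one_eq_oneStep`).
HONEST SCOPE.  [folklore] two `rw`-readings of landed one-step certificates at block size `L^{n+1}`; NOT summit progress (cell pub-balaban: NE9 NOT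
PRINTED ∕ NOT PROVED, «NE9 ⇐ the named binders»; row WALLED ON A MODEL; spine PROVED 0/9; rung (B)+1 finite T⁴ — NOT infinite volume, NOT mass gap,
NOT Clay; HONEST DEPENDENCY: continuum YM on T⁴ ⇐ BetaPertH ∧ nine spine estimates (0/9 proved); BetaPertH ⇐ (D1) ∧ (D4) ∧ CAP+tail; G-an2-4
gates asym, D1 and NE2/3/4).  NEW file importing `B9Eq325ProjFormulaTower`, `B9Eq365QGGQLowerVariational`, `B9Thm311SitePrimeFormCoercive`;
nothing modified.  Net new unproved facts: 0.
-/

noncomputable section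

open scoped InnerProductSpace ComplexConjugate

namespace Literature.MathematicalPhysics.QuantumFieldTheory.Balaban1983to89.B9Thm311FlatLettersTower

open B4Sect5Torus (TSite)
open B9SectCLatticeCarrier (Bond)
open B9Eq311L2Pairing (WL2)
open B9Eq319QprimeTorus (fineP)
open B11Eq103H1Complex (SiteL2K covDerivL2K)
open B9Eq310HessianOperator (adTransportW)
open B9Eq315QTower (towerP)
open B9Eq326OperatorAssembly (QprimeW)
open B9Eq326OperatorTower (QprimeTowerW)
open B9Eq3119DeltaPiCarrier (laplacePrimeA GpOfU)
open B9Thm311DeltaPrimeA (laplacePrimeA_one_pos)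
open B9Eq316TowerFlatIsOneStep (siteL2Cast bondL2Cast towerP_eq_fineP_pow norm_siteL2Cast norm_bondL2Cast covDerivL2K_siteL2Cast)
open B9Eq324DeltaPrimeATower (laplacePrimeAk GpOfUk laplacePrimeAk_one_pos inner_laplacePrimeAk_one_eq)
open B9Eq325ProjFormulaTower (re_inner_QGGQk_one_eq_oneStep)
open B9Thm311SitePrimeFormCoercive (flat_site_strong_coercive)
open B9Eq365QGGQLowerVariational (qggq_coercive_one qggq_constant_diagonal_ge)

variable {d : ℕ} (L : ℕ) [NeZero L] (m : Fin d → ℕ) [∀ i, NeZero (m i)] (n : ℕ)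
  {𝔸 : Type*} [NormedRing 𝔸] [NormedAlgebra ℂ 𝔸] [CompleteSpace 𝔸] [NormOneClass 𝔸]
  {W : Type*} [NormedAddCommGroup W] [InnerProductSpace ℂ W] [FiniteDimensional ℂ W] (φ : W ≃ₗ[ℂ] 𝔸) (c₀ : ℝ) [Fact (0 < c₀)]
  (η : ℝ) (c₁ : ℝ) [Fact (0 < c₁)] {a' : ℝ}

/-! ## §1 `γ♭` one storey up: the strong flat coercivity of the site operator `Δ′_{a′,k}(1)` -/

omit [NeZero L] [∀ i, NeZero (m i)] [CompleteSpace 𝔸] [NormOneClass 𝔸] [FiniteDimensional ℂ W] [Fact (0 < c₁)] in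
/-- `‖D_1(Φ′λ)‖ = ‖D_1λ‖`: the flat covariant derivative's norm across the two typings of the finest torus. [cite: Balaban1985BackgroundPropagators, (3.3) pp.390–391, (3.11) p.392] -/
theorem norm_covDerivL2K_one_siteL2Cast (h : towerP L m (n + 1) = fineP (L ^ (n + 1)) m) (c : ℂ) (l : SiteL2K ℂ d (towerP L m (n + 1)) c₀ W) :
    ‖covDerivL2K ℂ c₀ c (adTransportW φ (fun _ : Bond d (fineP (L ^ (n + 1)) m) => (1 : 𝔸ˣ))) (siteL2Cast ℂ h l)‖ =
      ‖covDerivL2K ℂ c₀ c (adTransportW φ (fun _ : Bond d (towerP L m (n + 1)) => (1 : 𝔸ˣ))) l‖ := by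
  rw [covDerivL2K_siteL2Cast ℂ h, norm_bondL2Cast]
  rfl

omit [NormOneClass 𝔸] in
/-- **`γ♭` ONE STOREY UP — THE STRONG FLAT COERCIVITY OF THE `k`-LEVEL SITE OPERATOR**: along Bałaban's normalisation `c₁(ηL^{n+1})² = c₀(L^{n+1})^d`
with `0 < ηL^{n+1}`, `η ≠ 0`, `0 < a′`: `(1∕(2+2∕a′))·(‖D_1λ‖² + (ηL^{n+1})⁻²‖λ‖²) ≤ re⟪λ, Δ′_{a′,k}(1)λ⟫` — NE9 leaf-03's
`flat_site_strong_coercive` at block size `L^{n+1}` read through `B9Eq324DeltaPrimeATower.inner_laplacePrimeAk_one_eq`; constant free of `m`, `L`,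
`η`, `c₀`, `c₁` and of the number of levels. [cite: Balaban1985BackgroundPropagators, (3.24) p.394, Thm 3.11 p.416; Balaban1984PropagatorsI, (1.18) p.20; Balaban1983RegularityDecay, (2.27) p.580] -/
theorem flat_site_strong_coercive_tower (hη : η ≠ 0) (ha' : 0 < a') (hηL0 : 0 < η * (L : ℝ) ^ (n + 1))
    (hs : c₁ * (η * (L : ℝ) ^ (n + 1)) ^ 2 = c₀ * ((L : ℝ) ^ (n + 1)) ^ d) (lam : SiteL2K ℂ d (towerP L m (n + 1)) c₀ W) :
    (1 / (2 + 2 / a')) * (‖covDerivL2K ℂ c₀ ((η : ℂ))⁻¹ (adTransportW φ (fun _ : Bond d (towerP L m (n + 1)) => (1 : 𝔸ˣ))) lam‖ ^ 2 +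
        ((η * (L : ℝ) ^ (n + 1))⁻¹) ^ 2 * ‖lam‖ ^ 2) ≤
      RCLike.re ⟪lam, laplacePrimeAk L m n φ η (fun _ : Bond d (towerP L m (n + 1)) => (1 : 𝔸ˣ)) a' (c₁ := c₁) lam⟫_ℂ := by
  have h : towerP L m (n + 1) = fineP (L ^ (n + 1)) m := towerP_eq_fineP_pow L m (n + 1)
  have hcast : ((L ^ (n + 1) : ℕ) : ℝ) = (L : ℝ) ^ (n + 1) := by push_cast; ring
  have hηL0' : 0 < η * ((L ^ (n + 1) : ℕ) : ℝ) := by rw [hcast]; exact hηL0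
  have hs' : c₁ * (η * ((L ^ (n + 1) : ℕ) : ℝ)) ^ 2 = c₀ * (((L ^ (n + 1) : ℕ) : ℝ)) ^ d := by rw [hcast]; exact hs
  have key := flat_site_strong_coercive (L ^ (n + 1)) m φ (c₀ := c₀) (c₁ := c₁) hη ha' hηL0' hs' (siteL2Cast ℂ h lam)
  rw [norm_covDerivL2K_one_siteL2Cast L m n φ c₀ h, norm_siteL2Cast, hcast, ← inner_laplacePrimeAk_one_eq L m n φ η a' h] at key
  exact key

omit [NormOneClass 𝔸] in
/-- **On print's diagonal `ηL^{n+1} = 1`, `c₀(L^{n+1})^d = c₁`**: `(1∕(2+2∕a′))·(‖D_1λ‖² + ‖λ‖²) ≤ re⟪λ, Δ′_{a′,k}(1)λ⟫` — a constant depending on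
`a′` ONLY, for every number of levels. [cite: Balaban1985BackgroundPropagators, (3.24) p.394, (3.35) p.396, Thm 3.11 p.416] -/
theorem flat_site_strong_coercive_tower_diagonal (ha' : 0 < a') (hηL : η * (L : ℝ) ^ (n + 1) = 1)
    (hw : c₀ * ((L : ℝ) ^ (n + 1)) ^ d = c₁) (lam : SiteL2K ℂ d (towerP L m (n + 1)) c₀ W) :
    (1 / (2 + 2 / a')) * (‖covDerivL2K ℂ c₀ ((η : ℂ))⁻¹ (adTransportW φ (fun _ : Bond d (towerP L m (n + 1)) => (1 : 𝔸ˣ))) lam‖ ^ 2 +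
        ‖lam‖ ^ 2) ≤
      RCLike.re ⟪lam, laplacePrimeAk L m n φ η (fun _ : Bond d (towerP L m (n + 1)) => (1 : 𝔸ˣ)) a' (c₁ := c₁) lam⟫_ℂ := by
  have hηL0 : 0 < η * (L : ℝ) ^ (n + 1) := by rw [hηL]; exact one_pos
  have hLr : (0 : ℝ) < (L : ℝ) ^ (n + 1) := pow_pos (by exact_mod_cast Nat.pos_of_ne_zero (NeZero.ne L)) _
  have hη : η ≠ 0 := (pos_of_mul_pos_left hηL0 hLr.le).ne'
  have hs : c₁ * (η * (L : ℝ) ^ (n + 1)) ^ 2 = c₀ * ((L : ℝ) ^ (n + 1)) ^ d := by rw [hηL, one_pow, mul_one, hw]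
  have key := flat_site_strong_coercive_tower L m n φ c₀ η c₁ hη ha' hηL0 hs lam
  rwa [hηL, inv_one, one_pow, one_mul] at key

/-! ## §2 `κ♭` one storey up: the flat floor of the third operator `Q̃′_kG′_k(1)²Q̃′_k†` -/

omit [NormOneClass 𝔸] in
/-- **`κ♭` ONE STOREY UP — NE9 leaf-01's EXPLICIT, VOLUME-FREE FLOOR OF THE THIRD OPERATOR AT `k` LEVELS**: for `3 ≤ L^{n+1}`, `η ≠ 0`, `0 < a′` and
every coarse `ψ`, `κ♭·‖ψ‖² ≤ re⟪ψ, Q̃′_kG′_k(1)²Q̃′_k†ψ⟫` with `κ♭ = κ♭(L^{n+1}, η, c₀(L^{n+1})^d∕c₁, a′, d)` the constant of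
`B9Eq365QGGQLowerVariational.qggq_coercive_one` AT BLOCK SIZE `L^{n+1}` — `B9Eq325ProjFormulaTower.re_inner_QGGQk_one_eq_oneStep` + leaf-01's theorem
BY NAME. [cite: Balaban1985BackgroundPropagators, Thm 3.11 p.416, (3.25) p.394; Balaban1984PropagatorsII, (2.74)–(2.77) p.236; Balaban1984PropagatorsI, (1.18) p.20] -/
theorem qggqk_coercive_one (hL3 : 3 ≤ L ^ (n + 1)) (hη : η ≠ 0) (ha' : 0 < a') (ψ : SiteL2K ℂ d m c₁ W) :
    ((((((L : ℝ) ^ (n + 1)) - 1) * (((L : ℝ) ^ (n + 1)) - 2) / 6) ^ d) ^ 2 /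
          (‖((η : ℂ))⁻¹‖ ^ 2 * (((L : ℝ) ^ (n + 1)) * (((L : ℝ) ^ (n + 1)) ^ 2 / 4) ^ (d - 1)) ^ 2 * (d : ℝ) *
              (c₀ * ((L : ℝ) ^ (n + 1)) ^ d / c₁) +
            a' * (((((L : ℝ) ^ (n + 1)) - 1) * (((L : ℝ) ^ (n + 1)) - 2) / 6) ^ d) ^ 2)) ^ 2 * (c₀ * ((L : ℝ) ^ (n + 1)) ^ d / c₁) * ‖ψ‖ ^ 2 ≤
      RCLike.re ⟪ψ, (((WL2.linearEquiv ℂ ℂ (fun _ : TSite d m => c₁)).symm.toLinearMap ∘ₗ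
          QprimeTowerW L m n φ (fun _ : Bond d (towerP L m (n + 1)) => (1 : 𝔸ˣ)) (c₀ := c₀)) ∘ₗ
          GpOfUk L m n φ η (fun _ : Bond d (towerP L m (n + 1)) => (1 : 𝔸ˣ)) a' (c₁ := c₁) (laplacePrimeAk_one_pos L m n φ η a' hη ha') ∘ₗ
            GpOfUk L m n φ η (fun _ : Bond d (towerP L m (n + 1)) => (1 : 𝔸ˣ)) a' (c₁ := c₁) (laplacePrimeAk_one_pos L m n φ η a' hη ha') ∘ₗ
              LinearMap.adjoint ((WL2.linearEquiv ℂ ℂ (fun _ : TSite d m => c₁)).symm.toLinearMap ∘ₗ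
                QprimeTowerW L m n φ (fun _ : Bond d (towerP L m (n + 1)) => (1 : 𝔸ˣ)) (c₀ := c₀))) ψ⟫_ℂ := by
  have h : towerP L m (n + 1) = fineP (L ^ (n + 1)) m := towerP_eq_fineP_pow L m (n + 1)
  have hcast : ((L ^ (n + 1) : ℕ) : ℝ) = (L : ℝ) ^ (n + 1) := by push_cast; ring
  rw [re_inner_QGGQk_one_eq_oneStep L m n φ c₀ η c₁ a' h _ (laplacePrimeA_one_pos (L ^ (n + 1)) m φ η a' hη ha')]
  have key := qggq_coercive_one (L ^ (n + 1)) m φ c₀ η c₁ hL3 hη ha' ψ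
  rw [hcast] at key
  exact key

omit [NormOneClass 𝔸] in
/-- **On print's diagonal `ηL^{n+1} = 1`, `c₀(L^{n+1})^d = c₁` (`3 ≤ L^{n+1}`, `0 < a′`): `(16d·(729∕16)^d + a′)^{−2}·‖ψ‖² ≤ re⟪ψ, Q̃′_kG′_k(1)²Q̃′_k†ψ⟫`**
— leaf-01's `qggq_constant_diagonal_ge` at block `L^{n+1}`: the `k`-level flat floor is a number depending on `d` and `a′` ONLY, for every number of
levels and every volume (`η ≠ 0`, implied by the diagonal, is kept as the binder the positivity witness `laplacePrimeAk_one_pos` is stated with). [cite: Balaban1985BackgroundPropagators, Thm 3.11 p.416, (3.25) p.394, (3.35) p.396] -/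
theorem qggqk_coercive_one_diagonal (hL3 : 3 ≤ L ^ (n + 1)) (hη : η ≠ 0) (ha' : 0 < a') (hηL : η * (L : ℝ) ^ (n + 1) = 1)
    (hw : c₀ * ((L : ℝ) ^ (n + 1)) ^ d = c₁) (ψ : SiteL2K ℂ d m c₁ W) :
    1 / (16 * (d : ℝ) * (729 / 16) ^ d + a') ^ 2 * ‖ψ‖ ^ 2 ≤
      RCLike.re ⟪ψ, (((WL2.linearEquiv ℂ ℂ (fun _ : TSite d m => c₁)).symm.toLinearMap ∘ₗ
          QprimeTowerW L m n φ (fun _ : Bond d (towerP L m (n + 1)) => (1 : 𝔸ˣ)) (c₀ := c₀)) ∘ₗ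
          GpOfUk L m n φ η (fun _ : Bond d (towerP L m (n + 1)) => (1 : 𝔸ˣ)) a' (c₁ := c₁) (laplacePrimeAk_one_pos L m n φ η a' hη ha') ∘ₗ
            GpOfUk L m n φ η (fun _ : Bond d (towerP L m (n + 1)) => (1 : 𝔸ˣ)) a' (c₁ := c₁) (laplacePrimeAk_one_pos L m n φ η a' hη ha') ∘ₗ
              LinearMap.adjoint ((WL2.linearEquiv ℂ ℂ (fun _ : TSite d m => c₁)).symm.toLinearMap ∘ₗ
                QprimeTowerW L m n φ (fun _ : Bond d (towerP L m (n + 1)) => (1 : 𝔸ˣ)) (c₀ := c₀))) ψ⟫_ℂ := by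
  have hc₁ : 0 < c₁ := Fact.out
  have hcast : ((L ^ (n + 1) : ℕ) : ℝ) = (L : ℝ) ^ (n + 1) := by push_cast; ring
  have hηL' : η * ((L ^ (n + 1) : ℕ) : ℝ) = 1 := by rw [hcast]; exact hηL
  have hw' : c₀ * (((L ^ (n + 1) : ℕ) : ℝ)) ^ d = c₁ := by rw [hcast]; exact hw
  have hκ := qggq_constant_diagonal_ge (d := d) hL3 hηL' hw' hc₁ ha'
  rw [hcast] at hκ
  exact (mul_le_mul_of_nonneg_right hκ (sq_nonneg _)).trans (qggqk_coercive_one L m n φ c₀ η c₁ hL3 hη ha' ψ)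

end Literature.MathematicalPhysics.QuantumFieldTheory.Balaban1983to89.B9Thm311FlatLettersTower

end
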